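import Summits.BirchSwinnertonDyer.BirchSwinnertonDyer.Theses.ErratumRoadFive
import Summits.BirchSwinnertonDyer.BirchSwinnertonDyer.Theorems.ErratumRoadFiveKernelFromPrintBRamFree
import Summits.BirchSwinnertonDyer.BirchSwinnertonDyer.Theorems.ErratumRoadFiveIMCDivRoadFFCoreBRamFreeOfThm23SelfDualIrrK
import Summits.BirchSwinnertonDyer.BirchSwinnertonDyer.Theorems.ErratumRoadFiveErratumThm23SelfDualIrrKOfTwoVarCoreThm326
import HarnessLib

/-!
# Rung K2a (route `ErratumRoadFive`, rev 71) — crux 19703 `Rest3NoWitnessBranchAtFive` and 19624 `RamNoErratumDataAtFive` BY NAME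
# from S1‡ (the print-faithful two-variable core, [FW21 Thm. 4.41] AS PRINTED) + route ITEMS + the shrunken residual «19703‡»

Cell `bsd-stepL`, seat `bsd-stepL-imc-p1` (prover g32, 2026-08-29); `--supports stmt-BirchSwinnertonDyer-19703 --as helper`. The
assembly of step K4 of `HOME/imc-p1/g26/RAMFREE-REKEY-PROPOSAL.md` as a PARTIAL RESULT on the open crux 19703: its NEW_A rows (census
j319451: 7 548 of 699 517 pairs with `N < 5·10⁵` — (ram) by some prime, an ODD NON-SPLIT multiplicative `q ≠ p` with
`p ∣ ord_q(Δ_min)`, `E(ℚ_p)[p] = 0`) are served by the erratum road with `ρ̄_{E,p}` onto taken from the OTHER ramified prime, so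
that 19703 REDUCES to «19703‡» = `Rest3NoOddNonsplitBranchAtFive` of the memo §2 ((ram), `E(ℚ_p)[p] = 0`, NO odd non-split
multiplicative `q ≠ p` at all) modulo the SAME open input S1‡ the (ram) road uses and published facts. Imports the route file
(item names) — hence not importable by a route file itself; the Theses-free kernel is `ErratumRoadFiveKernelFromPrintBRamFree` +
`ErratumRoadFiveIMCDivRoadFFCoreBRamFreeOfThm23SelfDualIrrK`.

## What this file proves (theorems only; no definition, no named fact, no `sorry`)

* `rest3NoWitnessBranchAtFive_of_thm23SelfDualIrrK_OPEN_of_items` — `Theses.ErratumRoadFive.Rest3NoWitnessBranchAtFive` (19703)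
  ⟸ F4♯‡ (`Castella2018.erratumThm23_charIdeal_sigma_le_of_isTorsion_selfDual_irrK_OPEN`, OPEN; the print-faithful twin of crux
  23253) + F3♯‡ (`Castella2018.erratum_exists_frames_members_sigma_congruence_wt_ramFree`, PUB, p694306) + ITEMS 20495
  `JSWSigmaLocalCharIdeal` (proved), 19283 `PublishedInputsIMCReduction`, 19625 `BDPValueContinuityInput`, 19285
  `WuthrichShaDividesAnalyticSha`, 19626 `JSWAnticyclotomicControlMult` (proved) + «19703‡» (inline hypothesis, NOT an item).
* `rest3NoWitnessBranchAtFive_of_FW21IrrK_of_items` — the same with F4♯‡ replaced by S1‡ (section hypothesis `hFW`, stated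
  once — byte-identical with g31's `RekeyIrrK` block) + ITEM 23081 `HidaOrdinaryUnitRootFact`, through g31's ‡ chain
  `ErratumChainSelfDualIrrK.erratumThm23SigmaLeSelfDualIrrK_OPEN_of_twoVarCoreIrrK_of_thm326` (p690124).
* `ramNoErratumDataAtFive_of_thm23SelfDualIrrK_OPEN_of_items` ∕ `ramNoErratumDataAtFive_of_FW21IrrK_of_items` — 19624
  `RamNoErratumDataAtFive` (REST‴, `closes` binder `hrest`) from ITEM 19702 `Rest3TorsionBranchAtFive` + the same, via the
  planner's glue `RamNoErratumDataAtFiveGlueBy_holds`.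

So, for the pen (reading, not a registry act): on a day-slot GO the re-partition «19703 ↦ 19703‡» of RULING 86 (c) costs NO
kernel work — `Theses.ErratumRoadFive.closes` keeps `hrest : RamNoErratumDataAtFive` and obtains it from 19702 + 19703‡ by the
last theorem here, or the planner re-cuts 19624 ∕ 19703 to the ‡ texts and cites these theorems as the fold.

HONEST FRAMING: CONDITIONAL on S1‡ ∕ F4♯‡ (OPEN: [FW21 Thm. 4.41] + App. B + the weight-`k` pin + [Hsi14 Thm. B], unrefereed)
and on the listed items; no item closes (19703‡ is a genuine residual: no road in print for the (ram) pairs whose only odd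
multiplicative primes `q ≠ p` are split, or whose only non-split ones are `2` or `p`); BSD is proved for no pair; the
anticyclotomic main conjecture is asserted nowhere; closes: none (T7).

References: [Castella2018Erratum] Thm. 1.1 (iii), Thm. 2.3 (i)/(iii), (2.4)–(2.5), proof of Thm. 1.1 (pp. 1–4); [FouquetWan2021]
Thm. 4.41, App. B Cor. 7.21, L. 7.22 (PREPRINT); [Wiles1988] Thm. 2.2; [JetchevSkinnerWan2017] Thm. 3.3.1, §5.1, Thm. 6.1.6;
[Wuthrich2014] Prop. 21; [Castella2018Exceptional] Thms. 2.10–2.11; cell files `HOME/imc-p1/g26/RAMFREE-REKEY-PROPOSAL.md`,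
`HOME/imc-p1/g31/K6-CHAIN-imc-p1-g31.md`.
[claim: FouquetWan2021, Thm. 4.41, App. B Cor. 7.21, Lemma 7.22, status: under-review] [claim: Castella2018Erratum, Thm. 2.3, status: under-review]
-/

set_option autoImplicit false
-- D-0017: single-problem summit, the namespace repeats the problem name by design.
set_option linter.dupNamespace false

noncomputable section

open scoped Classical
open PowerSeries NumberField IsDedekindDomain Field WeierstrassCurve
  Literature.NumberTheory.EllipticCurves Literature.NumberTheory.EllipticCurves.ModularForms
  Literature.NumberTheory.EllipticCurves.BigGaloisRep Literature.NumberTheory.EllipticCurves.GreenbergSelmer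
  Literature.NumberTheory.GaloisRepresentations Literature.NumberTheory.EllipticCurves.Castella2018
  Literature.NumberTheory.EllipticCurves.Rank1Residual
open Summit.BirchSwinnertonDyer.Rank1Residual Summit.BirchSwinnertonDyer.Rank1Residual.X11b
open Summit.BirchSwinnertonDyer.BirchSwinnertonDyer.Theses.ErratumRoadFive

namespace Summit.BirchSwinnertonDyer.BirchSwinnertonDyer.Theorems.RamFreeRekey

/-! ### §1 From F4♯‡ + F3♯‡ + items + «19703‡» -/

section Thm23IrrK

/-- **CRUX 19703 `Rest3NoWitnessBranchAtFive` BY NAME ⟸ F4♯‡ + F3♯‡ + ITEMS 20495, 19283, 19625, 19285, 19626 + «19703‡».** The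
ram-free core shape of every pair is Road FF's `P2.imcDivIntCoreFrameAtErratumDataBRamFree_of_thm23SelfDualIrrK_OPEN_of_framesWtRamFree_of_facts`
(Shapiro fed by the tree's `SkinnerUrban2014.prop323_XAc_equiv_XBigDecomp_holds`, GZK ∕ modularity ∕ Poitou–Tate read out of
19283's conjunction), then `KernelFromPrintBRamFree.rest3NoWitnessBranchAtFive_of_print_of_coreBRamFree_of_noOddNonsplit`.
CONDITIONAL (F4♯‡ OPEN); no item closes. [cite: Castella2018Erratum, Thm. 1.1 (iii), Thm. 2.3, (2.4)–(2.5) (pp. 1–4)]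
[cite: FouquetWan2021, Thm. 4.41 (hypotheses (i)–(iii) as printed)] -/
theorem rest3NoWitnessBranchAtFive_of_thm23SelfDualIrrK_OPEN_of_items
    (h23 : erratumThm23_charIdeal_sigma_le_of_isTorsion_selfDual_irrK_OPEN)
    (hMF : erratum_exists_frames_members_sigma_congruence_wt_ramFree)
    (hloc : JSWSigmaLocalCharIdeal) (hF : PublishedInputsIMCReduction) (hVN : BDPValueContinuityInput)
    (hWu : WuthrichShaDividesAnalyticSha) (h331 : JSWAnticyclotomicControlMult)
    (hrest : ∀ (W : WeierstrassCurve ℚ) [W.IsElliptic] [W.IsGloballyMinimal] (p : ℕ) [Fact p.Prime],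
      Ram W p → (∀ P₀ : (W.baseChange ℚ_[p]).toAffine.Point, p • P₀ = 0 → P₀ = 0) →
      ¬ (∃ (q : ℕ) (_ : Fact q.Prime), q ≠ 2 ∧ q ≠ p ∧ Mult W q ∧
          ¬ W.HasSplitMultiplicativeReductionAtPrime q) →
      P2OpenInputOnTreeAt W p) :
    Rest3NoWitnessBranchAtFive :=
  KernelFromPrintBRamFree.rest3NoWitnessBranchAtFive_of_print_of_coreBRamFree_of_noOddNonsplit hVN
    (fun W _ _ p _ ↦
      P2.imcDivIntCoreFrameAtErratumDataBRamFree_of_thm23SelfDualIrrK_OPEN_of_framesWtRamFree_of_facts h23 hMF hloc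
        Literature.NumberTheory.EllipticCurves.SkinnerUrban2014.prop323_XAc_equiv_XBigDecomp_holds
        hF.2.1 hF.2.2.2.1 hF.2.2.2.2.2.2.2.2.2.2.2.2.1 hF.2.2.2.2.2.2.2.2.2.2.2.2.2.1 W p)
    hF hWu h331 hrest

/-- **19624 `RamNoErratumDataAtFive` (REST‴, the `closes` binder `hrest`) BY NAME ⟸ ITEM 19702 `Rest3TorsionBranchAtFive` + F4♯‡ +
F3♯‡ + the same items + «19703‡»**, by the planner's glue `RamNoErratumDataAtFiveGlueBy_holds`. CONDITIONAL; no item closes.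
[cite: Castella2018Erratum, Thm. 1.1 (iii)–(iv) (p. 1)] -/
theorem ramNoErratumDataAtFive_of_thm23SelfDualIrrK_OPEN_of_items
    (hT : Rest3TorsionBranchAtFive)
    (h23 : erratumThm23_charIdeal_sigma_le_of_isTorsion_selfDual_irrK_OPEN)
    (hMF : erratum_exists_frames_members_sigma_congruence_wt_ramFree)
    (hloc : JSWSigmaLocalCharIdeal) (hF : PublishedInputsIMCReduction) (hVN : BDPValueContinuityInput)
    (hWu : WuthrichShaDividesAnalyticSha) (h331 : JSWAnticyclotomicControlMult)
    (hrest : ∀ (W : WeierstrassCurve ℚ) [W.IsElliptic] [W.IsGloballyMinimal] (p : ℕ) [Fact p.Prime],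
      Ram W p → (∀ P₀ : (W.baseChange ℚ_[p]).toAffine.Point, p • P₀ = 0 → P₀ = 0) →
      ¬ (∃ (q : ℕ) (_ : Fact q.Prime), q ≠ 2 ∧ q ≠ p ∧ Mult W q ∧
          ¬ W.HasSplitMultiplicativeReductionAtPrime q) →
      P2OpenInputOnTreeAt W p) :
    RamNoErratumDataAtFive :=
  RamNoErratumDataAtFiveGlueBy_holds hT
    (rest3NoWitnessBranchAtFive_of_thm23SelfDualIrrK_OPEN_of_items h23 hMF hloc hF hVN hWu h331 hrest)

end Thm23IrrK

/-! ### §2 From S1‡ (stated once as a section hypothesis) + ITEM 23081 + the same -/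

section FW21IrrK

/-! The print-faithful two-variable core S1‡ — byte-identical with the `hFW` block of g31's
`Theorems/ErratumRoadFiveClosesOfFW21IrrK.lean` (= binder `hFW` of
`ErratumChainSelfDualIrrK.erratumThm23SigmaLeSelfDualIrrK_OPEN_of_twoVarCoreIrrK_of_thm326`). -/

variable
    (hFW :
    ∀ {p : ℕ} [Fact p.Prime] (ι : PadicAlgCl p ≃+* ℂ) {M : ℕ} [NeZero M] {k : ℤ}
      (g : CuspForm (CongruenceSubgroup.Gamma0 M) k) (ιg : coeffField g →+* PadicAlgCl p)
      (Δ : OrdinaryNewformDatum g p ιg)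
      (K : Type) [Field K] [NumberField K] (𝔭 𝔭bar : HeightOneSpectrum (𝓞 K)) (κ : ZpExtension K p)
      (γ : absoluteGaloisGroup K) [Fact (κ.IsTopGenerator γ)] (S : Finset (HeightOneSpectrum (𝓞 K))),
      IsNewform0 g → 2 ≤ k → Even k → 3 ≤ M → ¬ p ∣ M → 3 < p →
      (∀ x : coeffField g, ι (ιg x) = (x : ℂ)) →
      ‖ιg ⟨(UpperHalfPlane.qExpansion 1 ⇑g).coeff p, coeff_mem_coeffField g p⟩‖ = 1 →
      IsImaginaryQuadratic K → (∃ β : ℤ, (4 * M : ℤ) ∣ β ^ 2 - NumberField.discr K) →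
      ((Ideal.span {(p : ℤ)}).primesOver (𝓞 K)).ncard = 2 →
      ((p : ℕ) : 𝓞 K) ∈ 𝔭.asIdeal →
      (∀ (w : InfinitePlace K) (x : 𝓞 K), x ∈ 𝔭.asIdeal ↔ ‖ι.symm (w.embedding (x : K))‖ < 1) →
      ((p : ℕ) : 𝓞 K) ∈ 𝔭bar.asIdeal → 𝔭bar ≠ 𝔭 →
      -- (i) AS PRINTED: `ρ̄_g|_{G_K}` irreducible (erratum Thm. 2.3 (i); [FW21, Thm. 4.41] first bullet)
      IsSimpleOrder (Subrepresentation
        ((SkinnerUrban2014.residualRep Δ).comp (absGaloisRestrict ℚ K : absoluteGaloisGroup K →* absoluteGaloisGroup ℚ))) →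
      -- (iii) AS PRINTED: some prime `q ∥ M` is non-split in `K` (erratum Thm. 2.3 (iii); [FW21, Thm. 4.41] third bullet)
      (∃ q : ℕ, q.Prime ∧ q ∣ M ∧ ¬ q ^ 2 ∣ M ∧ ((Ideal.span {(q : ℤ)}).primesOver (𝓞 K)).ncard ≠ 2) →
      (((Ideal.span {(2 : ℤ)}).primesOver (𝓞 K)).ncard ≠ 2 → (2 ∣ M ∧ ¬ 4 ∣ M)) →
      (∀ ℓ : ℕ, ℓ.Prime → ℓ ∣ M → ((Ideal.span {(ℓ : ℤ)}).primesOver (𝓞 K)).ncard ≠ 2 →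
        ¬ ℓ ^ 2 ∣ M ∧ (UpperHalfPlane.qExpansion 1 ⇑g).coeff ℓ = -((ℓ : ℂ) ^ (k / 2 - 1).toNat)) →
      κ.IsAnticyclotomic → (∀ w ∈ S, ((p : ℕ) : 𝓞 K) ∉ w.asIdeal) →
      (∀ w : HeightOneSpectrum (𝓞 K), ((M : ℕ) : 𝓞 K) ∈ w.asIdeal → w ∈ S) →
      ∀ (b : padicCoeffIntegers ιg →+* PadicComplexInt p),
        (∀ x, ((b x : PadicComplexInt p) : ℂ_[p]) =
          algebraMap (PadicAlgCl p) ℂ_[p] (padicCoeffIntegers.toPadicAlgCl ιg x)) →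
      ∀ (ΩK : ℂ) (Ωp : (PadicComplexInt p)ˣ) (Q : PowerSeries (PadicComplexInt p)), ΩK ≠ 0 →
        IsBDPLFunctionWtSigmaInt ι 𝔭 κ γ g S ΩK ((Ωp : PadicComplexInt p) : ℂ_[p]) Q →
      -- the complementary (cyclotomic) direction `κ'` with generator `γ'`: `Γ_K = Γ⁺ ⊕ Γ⁻ ≅ ℤ_p²` for `p` odd
      ∀ (κ' : ZpExtension K p) (γ' : absoluteGaloisGroup K) [Fact (κ'.IsTopGenerator γ')], κ'.IsCyclotomic →
      ∀ [TopologicalSpace (PowerSeries (padicCoeffIntegers ιg))]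
        [TopologicalSpace (PowerSeries (PowerSeries (padicCoeffIntegers ιg)))]
        [ContinuousSMul (PowerSeries (PowerSeries (padicCoeffIntegers ιg)))
          (BigRepModule (PowerSeries (padicCoeffIntegers ιg)) p
            (BigRepModule (padicCoeffIntegers ιg) p (Cofree Δ.selfDualRep (padicCoeffField ιg))))],
      -- premise: `X^Σ_K(A_g)` is `Λ_K`-torsion; conclusion: a two-variable frame pinned to `Q` on `X = 0` dividing `Ch_{Λ_K}(X^Σ_K(A_g))`
      Module.IsTorsion (PowerSeries (PowerSeries (padicCoeffIntegers ιg)))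
          (XBig κ' (AnticyclotomicBigGaloisRep κ (Δ.selfDualCofreeRepOver K)) 𝔭bar (↑S)) →
      ∃ Q₂ : PowerSeries (PowerSeries (PadicComplexInt p)),
        (∃ u : (PowerSeries (PadicComplexInt p))ˣ,
            PowerSeries.constantCoeff Q₂ = (u : PowerSeries (PadicComplexInt p)) * Q) ∧
        (XBig.charIdeal κ' (AnticyclotomicBigGaloisRep κ (Δ.selfDualCofreeRepOver K)) 𝔭bar (↑S)).map
            (PowerSeries.map (PowerSeries.map b)) ≤ Ideal.span {Q₂} )
    (hW : HidaOrdinaryUnitRootFact)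

include hFW hW

/-- **CRUX 19703 `Rest3NoWitnessBranchAtFive` BY NAME ⟸ S1‡ + ITEM 23081 `HidaOrdinaryUnitRootFact` + F3♯‡ + ITEMS 20495, 19283,
19625, 19285, 19626 + «19703‡»** — the previous section after g31's ‡ chain (F4♯‡ ⟸ S1‡ + [Wiles88 2.2]). CONDITIONAL (S1‡ OPEN);
no item closes. [cite: Castella2018Erratum, Thm. 2.3 (i), (iii), proof (2.4) ⇒ (2.5) (pp. 3–4)] [cite: Wiles1988, Thm. 2.2]
[cite: FouquetWan2021, Thm. 4.41] -/
theorem rest3NoWitnessBranchAtFive_of_FW21IrrK_of_items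
    (hMF : erratum_exists_frames_members_sigma_congruence_wt_ramFree)
    (hloc : JSWSigmaLocalCharIdeal) (hF : PublishedInputsIMCReduction) (hVN : BDPValueContinuityInput)
    (hWu : WuthrichShaDividesAnalyticSha) (h331 : JSWAnticyclotomicControlMult)
    (hrest : ∀ (W : WeierstrassCurve ℚ) [W.IsElliptic] [W.IsGloballyMinimal] (p : ℕ) [Fact p.Prime],
      Ram W p → (∀ P₀ : (W.baseChange ℚ_[p]).toAffine.Point, p • P₀ = 0 → P₀ = 0) →
      ¬ (∃ (q : ℕ) (_ : Fact q.Prime), q ≠ 2 ∧ q ≠ p ∧ Mult W q ∧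
          ¬ W.HasSplitMultiplicativeReductionAtPrime q) →
      P2OpenInputOnTreeAt W p) :
    Rest3NoWitnessBranchAtFive :=
  rest3NoWitnessBranchAtFive_of_thm23SelfDualIrrK_OPEN_of_items
    (ErratumThm23TwoVariable.ErratumChainSelfDualIrrK.erratumThm23SigmaLeSelfDualIrrK_OPEN_of_twoVarCoreIrrK_of_thm326
      hFW hW)
    hMF hloc hF hVN hWu h331 hrest

/-- **19624 `RamNoErratumDataAtFive` BY NAME ⟸ ITEM 19702 + S1‡ + ITEM 23081 + F3♯‡ + the same items + «19703‡».** CONDITIONAL;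
no item closes. [cite: Castella2018Erratum, Thm. 1.1 (iii)–(iv) (p. 1)] [cite: FouquetWan2021, Thm. 4.41] -/
theorem ramNoErratumDataAtFive_of_FW21IrrK_of_items
    (hT : Rest3TorsionBranchAtFive)
    (hMF : erratum_exists_frames_members_sigma_congruence_wt_ramFree)
    (hloc : JSWSigmaLocalCharIdeal) (hF : PublishedInputsIMCReduction) (hVN : BDPValueContinuityInput)
    (hWu : WuthrichShaDividesAnalyticSha) (h331 : JSWAnticyclotomicControlMult)
    (hrest : ∀ (W : WeierstrassCurve ℚ) [W.IsElliptic] [W.IsGloballyMinimal] (p : ℕ) [Fact p.Prime],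
      Ram W p → (∀ P₀ : (W.baseChange ℚ_[p]).toAffine.Point, p • P₀ = 0 → P₀ = 0) →
      ¬ (∃ (q : ℕ) (_ : Fact q.Prime), q ≠ 2 ∧ q ≠ p ∧ Mult W q ∧
          ¬ W.HasSplitMultiplicativeReductionAtPrime q) →
      P2OpenInputOnTreeAt W p) :
    RamNoErratumDataAtFive :=
  RamNoErratumDataAtFiveGlueBy_holds hT
    (rest3NoWitnessBranchAtFive_of_FW21IrrK_of_items hFW hW hMF hloc hF hVN hWu h331 hrest)

end FW21IrrK

end Summit.BirchSwinnertonDyer.BirchSwinnertonDyer.Theorems.RamFreeRekey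

end
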